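import Mathlib
import Summits.ValiantsHypothesis.ValiantsHypothesis.Theorems.RigidityForcesSymmetryRankRigidMinimalReprLaplaceDefs

/-!
# The functional dual of a split-rank-one decomposition: permanent vanishing on the killing variety
# (crux `RankRigidMinimalRepr`, stmt-ValiantsHypothesis-18034; frontier rung `LaplaceOptimalFive`, stmt-24813)

The DUAL (substitution) form of `LaplaceOptimal d`, the only kind of argument that can prove the EXACT statement
(`LaplaceOptimal 4` is border-false, so no Zariski-closed invariant of the terms separates).  Pair the identity
`[v injective] = Σ_t u_t(v|_{S_t}) w_t(v|_{S_tᶜ})` against a product of covectors `φ_0 ⊗ ⋯ ⊗ φ_{d-1}`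
(`φ_i : Fin d → ℂ`, one per slot):

* `perm_pairing` — the pattern side is a PERMANENT: `Σ_v [v injective] Π_i φ_i(v_i) = per (φ_i(c))_{c,i}`;
* `pairing_split` — a split term FACTORS (Fubini over the slots of `S` and of `Sᶜ`):
  `Σ_v Π_i φ_i(v_i) u(v) w(v) = A_S(φ, u) · B_S(φ, w)`, where `A_S` pairs `u` with the covectors of the slots in `S`
  (the other slots parked at a base value `c₀`, on which `u` does not depend) and `B_S` pairs `w` with the others;
* `permanent_eq_sum_pairings` — hence `per (φ_i(c)) = Σ_t A_{S_t}(φ, u_t) · B_{S_t}(φ, w_t)`;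
* `dual_vanishing` — if `φ` KILLS every term (`A_{S_t}(φ,u_t) = 0` or `B_{S_t}(φ,w_t) = 0` for each `t`), then
  `per (φ_i(c))_{c,i} = 0`.  Contrapositive (`no_decomposition_of_witness`): a covector tuple killing all terms of a
  purported decomposition with non-zero permanent refutes it.  A slice (`S = {i}`, `u = α(v_i)`) is killed by the
  linear condition `φ_i ⊥ α`; a pair term (`S = {p,q}`) by the bilinear condition `φ_pᵀ g φ_q = 0`.  So
  `LaplaceOptimal 5` follows from: the `5 × 5` permanent does not vanish identically on any "cheap killing variety"
  (`a` linear + `b` bilinear slot conditions, `24a + 12b ≤ 108`) — the programme's working formulation (evidence note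
  NOTE-p8g10-24813 on the item).

No new definitions (the pairings are written out).  HONEST FRAMING: infrastructure for the frontier rung
`LaplaceOptimalFive` (stmt-24813), which stays OPEN; the crux stays OPEN; nothing here bears on `VP ≠ VNP`.
-/

set_option autoImplicit false

-- the mandated summit-side namespace repeats a component by design (single-problem summit)
set_option linter.dupNamespace false

namespace Summit.ValiantsHypothesis.ValiantsHypothesis.Theorems.RigidityForcesSymmetryRankRigidMinimalRepr

namespace LaplaceDual

open Finset

variable {d : ℕ}

/-! ### §1 The pattern side: a permanent -/

/-- **The pattern pairs to a permanent**: `Σ_v (Π_i φ_i(v_i)) · [v injective] = per M` with `M c i = φ_i(c)`. -/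
theorem perm_pairing (φ : Fin d → Fin d → ℂ) :
    (∑ v : Fin d → Fin d, (∏ i, φ i (v i)) * (if Function.Injective v then (1 : ℂ) else 0)) =
      (Matrix.of fun c i => φ i c).permanent := by
  classical
  unfold Matrix.permanent
  have h1 : (∑ v : Fin d → Fin d, (∏ i, φ i (v i)) * (if Function.Injective v then (1 : ℂ) else 0)) =
      ∑ v ∈ univ.filter (fun v : Fin d → Fin d => Function.Injective v), ∏ i, φ i (v i) := by
    rw [sum_filter]
    refine sum_congr rfl fun v _ => ?_
    split_ifs <;> simp
  rw [h1]
  symm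
  refine sum_nbij (fun σ : Equiv.Perm (Fin d) => (σ : Fin d → Fin d)) ?_ ?_ ?_ ?_
  · intro σ _
    simp [σ.injective]
  · intro σ _ τ _ h
    exact Equiv.ext (congrFun h)
  · intro v hv
    simp only [coe_filter, mem_univ, true_and, Set.mem_setOf_eq] at hv
    refine ⟨Equiv.ofBijective v (Finite.injective_iff_bijective.mp hv), by simp, ?_⟩
    ext i; rfl
  · intro σ _
    simp [Matrix.of_apply]

/-! ### §2 A split term factors -/

/-- **Fubini for a split term.**  If `u` depends only on the slots in `S` and `w` only on the slots outside `S`, then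
the pairing of `u · w` with `⊗_i φ_i` is the product of the `S`-pairing of `u` and the `Sᶜ`-pairing of `w` (the idle
slots parked at the base value `c₀`). -/
theorem pairing_split (c₀ : Fin d) (S : Finset (Fin d)) (φ : Fin d → Fin d → ℂ) (u w : (Fin d → Fin d) → ℂ)
    (hu : ∀ v v' : Fin d → Fin d, (∀ i ∈ S, v i = v' i) → u v = u v')
    (hw : ∀ v v' : Fin d → Fin d, (∀ i, i ∉ S → v i = v' i) → w v = w v') :
    (∑ v : Fin d → Fin d, (∏ i, φ i (v i)) * (u v * w v)) =
      (∑ v : Fin d → Fin d, (∏ i, if i ∈ S then φ i (v i) else if v i = c₀ then 1 else 0) * u v) *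
      (∑ v : Fin d → Fin d, (∏ i, if i ∈ S then (if v i = c₀ then 1 else 0) else φ i (v i)) * w v) := by
  classical
  -- the two partial pairings as functions of an assignment
  set F : (Fin d → Fin d) → ℂ := fun v => (∏ i, if i ∈ S then φ i (v i) else if v i = c₀ then 1 else 0) * u v
    with hF
  set G : (Fin d → Fin d) → ℂ := fun v => (∏ i, if i ∈ S then (if v i = c₀ then 1 else 0) else φ i (v i)) * w v
    with hG
  -- splitting an assignment into its `S`-part and its `Sᶜ`-part
  set sp : (Fin d → Fin d) → (Fin d → Fin d) × (Fin d → Fin d) :=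
    fun v => (fun i => if i ∈ S then v i else c₀, fun i => if i ∈ S then c₀ else v i) with hsp
  have hinj : Set.InjOn sp (univ : Finset (Fin d → Fin d)) := by
    intro v _ v' _ h
    simp only [hsp, Prod.mk.injEq] at h
    obtain ⟨h1, h2⟩ := h
    funext i
    by_cases hi : i ∈ S
    · simpa [hi] using congrFun h1 i
    · simpa [hi] using congrFun h2 i
  rw [sum_mul_sum, ← sum_product', univ_product_univ]
  change _ = ∑ p ∈ (univ : Finset ((Fin d → Fin d) × (Fin d → Fin d))), F p.1 * G p.2
  -- the double sum lives on the image of `sp`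
  have hzero : ∀ p ∈ (univ : Finset ((Fin d → Fin d) × (Fin d → Fin d))), p ∉ univ.image sp → F p.1 * G p.2 = 0 := by
    intro p _ hp
    by_contra hne
    apply hp
    have hF0 : F p.1 ≠ 0 := left_ne_zero_of_mul hne
    have hG0 : G p.2 ≠ 0 := right_ne_zero_of_mul hne
    have hF1 : ∀ i, i ∉ S → p.1 i = c₀ := by
      intro i hi
      have := (prod_ne_zero_iff.mp (left_ne_zero_of_mul hF0)) i (mem_univ i)
      simp only [hi, if_false] at this
      by_contra h; exact this (by simp [h])
    have hG1 : ∀ i, i ∈ S → p.2 i = c₀ := by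
      intro i hi
      have := (prod_ne_zero_iff.mp (left_ne_zero_of_mul hG0)) i (mem_univ i)
      simp only [hi, if_true] at this
      by_contra h; exact this (by simp [h])
    refine mem_image.mpr ⟨fun i => if i ∈ S then p.1 i else p.2 i, mem_univ _, ?_⟩
    simp only [hsp]
    ext i
    · by_cases hi : i ∈ S
      · simp [hi]
      · simp [hi, hF1 i hi]
    · by_cases hi : i ∈ S
      · simp [hi, hG1 i hi]
      · simp [hi]
  rw [← sum_subset (subset_univ (univ.image sp)) hzero, sum_image hinj]
  refine sum_congr rfl fun v _ => ?_
  -- pointwise: the product of covector values splits, `u` and `w` see only their own slots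
  have hu' : u (sp v).1 = u v := hu _ _ (fun i hi => by simp [hsp, hi])
  have hw' : w (sp v).2 = w v := hw _ _ (fun i hi => by simp [hsp, hi])
  have hprod : (∏ i, φ i (v i)) =
      (∏ i, if i ∈ S then φ i ((sp v).1 i) else if (sp v).1 i = c₀ then 1 else 0) *
      (∏ i, if i ∈ S then (if (sp v).2 i = c₀ then 1 else 0) else φ i ((sp v).2 i)) := by
    rw [← prod_mul_distrib]
    refine prod_congr rfl fun i _ => ?_
    by_cases hi : i ∈ S <;> simp [hsp, hi]
  simp only [hF, hG]
  rw [hu', hw', hprod]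
  ring

/-! ### §3 The dual identity and the vanishing criterion -/

/-- **The permanent as a sum of product pairings.**  For a split-rank-one decomposition of the pattern of order `d`
and any covector tuple `φ`: `per (φ_i(c)) = Σ_t A_{S_t}(φ,u_t) · B_{S_t}(φ,w_t)`. -/
theorem permanent_eq_sum_pairings {N : ℕ} (T : Finset (Fin N)) (S : Fin N → Finset (Fin d))
    (u w : Fin N → (Fin d → Fin d) → ℂ)
    (hu : ∀ t, ∀ v v' : Fin d → Fin d, (∀ i ∈ S t, v i = v' i) → u t v = u t v')
    (hw : ∀ t, ∀ v v' : Fin d → Fin d, (∀ i, i ∉ S t → v i = v' i) → w t v = w t v')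
    (hsum : ∀ v : Fin d → Fin d, (∑ t ∈ T, u t v * w t v) = if Function.Injective v then 1 else 0)
    (c₀ : Fin d) (φ : Fin d → Fin d → ℂ) :
    (Matrix.of fun c i => φ i c).permanent =
      ∑ t ∈ T, (∑ v : Fin d → Fin d, (∏ i, if i ∈ S t then φ i (v i) else if v i = c₀ then 1 else 0) * u t v) *
        (∑ v : Fin d → Fin d, (∏ i, if i ∈ S t then (if v i = c₀ then 1 else 0) else φ i (v i)) * w t v) := by
  rw [← perm_pairing]
  calc (∑ v : Fin d → Fin d, (∏ i, φ i (v i)) * (if Function.Injective v then (1 : ℂ) else 0))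
      = ∑ v : Fin d → Fin d, (∏ i, φ i (v i)) * ∑ t ∈ T, u t v * w t v := by
        refine sum_congr rfl fun v _ => ?_; rw [hsum]
    _ = ∑ v : Fin d → Fin d, ∑ t ∈ T, (∏ i, φ i (v i)) * (u t v * w t v) := by
        refine sum_congr rfl fun v _ => ?_; rw [mul_sum]
    _ = ∑ t ∈ T, ∑ v : Fin d → Fin d, (∏ i, φ i (v i)) * (u t v * w t v) := sum_comm
    _ = _ := by
        refine sum_congr rfl fun t _ => ?_
        exact pairing_split c₀ (S t) φ (u t) (w t) (hu t) (hw t)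

/-- **Dual vanishing.**  If a covector tuple `φ` KILLS every term of a split-rank-one decomposition of the pattern of
order `d` (for each `t`, the `S_t`-pairing of `u_t` or the `S_tᶜ`-pairing of `w_t` vanishes), then the permanent
`per (φ_i(c))_{c,i}` vanishes. -/
theorem dual_vanishing {N : ℕ} (T : Finset (Fin N)) (S : Fin N → Finset (Fin d))
    (u w : Fin N → (Fin d → Fin d) → ℂ)
    (hu : ∀ t, ∀ v v' : Fin d → Fin d, (∀ i ∈ S t, v i = v' i) → u t v = u t v')
    (hw : ∀ t, ∀ v v' : Fin d → Fin d, (∀ i, i ∉ S t → v i = v' i) → w t v = w t v')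
    (hsum : ∀ v : Fin d → Fin d, (∑ t ∈ T, u t v * w t v) = if Function.Injective v then 1 else 0)
    (c₀ : Fin d) (φ : Fin d → Fin d → ℂ)
    (hkill : ∀ t ∈ T,
      (∑ v : Fin d → Fin d, (∏ i, if i ∈ S t then φ i (v i) else if v i = c₀ then 1 else 0) * u t v) = 0 ∨
      (∑ v : Fin d → Fin d, (∏ i, if i ∈ S t then (if v i = c₀ then 1 else 0) else φ i (v i)) * w t v) = 0) :
    (Matrix.of fun c i => φ i c).permanent = 0 := by
  rw [permanent_eq_sum_pairings T S u w hu hw hsum c₀ φ]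
  refine sum_eq_zero fun t ht => ?_
  rcases hkill t ht with h | h <;> simp [h]

/-- **The refutation tool** (contrapositive of `dual_vanishing`): a covector tuple with NON-ZERO permanent that kills
every term shows that the purported split-rank-one decomposition of the pattern does not exist. -/
theorem no_decomposition_of_witness {N : ℕ} (T : Finset (Fin N)) (S : Fin N → Finset (Fin d))
    (u w : Fin N → (Fin d → Fin d) → ℂ)
    (hu : ∀ t, ∀ v v' : Fin d → Fin d, (∀ i ∈ S t, v i = v' i) → u t v = u t v')
    (hw : ∀ t, ∀ v v' : Fin d → Fin d, (∀ i, i ∉ S t → v i = v' i) → w t v = w t v')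
    (c₀ : Fin d) (φ : Fin d → Fin d → ℂ) (hper : (Matrix.of fun c i => φ i c).permanent ≠ 0)
    (hkill : ∀ t ∈ T,
      (∑ v : Fin d → Fin d, (∏ i, if i ∈ S t then φ i (v i) else if v i = c₀ then 1 else 0) * u t v) = 0 ∨
      (∑ v : Fin d → Fin d, (∏ i, if i ∈ S t then (if v i = c₀ then 1 else 0) else φ i (v i)) * w t v) = 0) :
    ¬ ∀ v : Fin d → Fin d, (∑ t ∈ T, u t v * w t v) = if Function.Injective v then 1 else 0 :=
  fun hsum => hper (dual_vanishing T S u w hu hw hsum c₀ φ hkill)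

/-! ### §4 Killing a slice: the linear condition -/

/-- **A slice is killed by an orthogonal covector.**  If `u` depends only on slot `i` (`S = {i}`), its `S`-pairing
is `(Σ_c φ_i(c) · u(c at slot i)) ·` — so `φ_i ⊥ (c ↦ u(v[i ↦ c]))` kills the term.  Precisely: the `{i}`-pairing
equals `Σ_c φ_i(c) · u(const c₀ updated at i to c)`. -/
theorem pairing_singleton (c₀ i : Fin d) (φ : Fin d → Fin d → ℂ) (u : (Fin d → Fin d) → ℂ) :
    (∑ v : Fin d → Fin d, (∏ j, if j ∈ ({i} : Finset (Fin d)) then φ j (v j) else if v j = c₀ then 1 else 0) * u v) =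
      ∑ c : Fin d, φ i c * u (Function.update (fun _ => c₀) i c) := by
  classical
  set f : Fin d → (Fin d → Fin d) := fun c => Function.update (fun _ => c₀) i c with hf
  have hinj : Set.InjOn f (univ : Finset (Fin d)) := by
    intro c _ c' _ h
    simpa [hf] using congrFun h i
  -- only the assignments `c₀[i ↦ c]` contribute
  have hzero : ∀ v ∈ (univ : Finset (Fin d → Fin d)), v ∉ univ.image f →
      (∏ j, if j ∈ ({i} : Finset (Fin d)) then φ j (v j) else if v j = c₀ then 1 else 0) * u v = 0 := by
    intro v _ hv
    by_contra hne
    apply hv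
    have hP := prod_ne_zero_iff.mp (left_ne_zero_of_mul hne)
    refine mem_image.mpr ⟨v i, mem_univ _, ?_⟩
    funext j
    by_cases hj : j = i
    · subst hj; simp [hf]
    · have := hP j (mem_univ j)
      simp only [mem_singleton, hj, if_false] at this
      have hvj : v j = c₀ := by by_contra h; exact this (by simp [h])
      show Function.update (fun _ => c₀) i (v i) j = v j
      rw [Function.update_of_ne hj, hvj]
  rw [← sum_subset (subset_univ (univ.image f)) hzero, sum_image hinj]
  refine sum_congr rfl fun c _ => ?_
  congr 1
  rw [Fintype.prod_eq_single i]
  · simp [hf]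
  · intro j hj
    simp [hf, hj]

/-- **Killing a slice.**  A term with `S = {i}` whose `u` (a function of `v_i` alone, `α(c) = u(c₀[i ↦ c])`) is
orthogonal to `φ_i` — `Σ_c φ_i(c) α(c) = 0` — is killed. -/
theorem kill_slice (c₀ i : Fin d) (φ : Fin d → Fin d → ℂ) (u : (Fin d → Fin d) → ℂ)
    (horth : (∑ c : Fin d, φ i c * u (Function.update (fun _ => c₀) i c)) = 0) :
    (∑ v : Fin d → Fin d, (∏ j, if j ∈ ({i} : Finset (Fin d)) then φ j (v j) else if v j = c₀ then 1 else 0) * u v) =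
      0 := by
  rw [pairing_singleton, horth]

/-! ### §5 Killing a pair term: the bilinear condition -/

/-- **The pairing of a pair term's `u`-factor** (`S = {p, q}`, `p ≠ q`): it equals the bilinear form
`Σ_{a,b} φ_p(a) φ_q(b) · u(c₀[p ↦ a][q ↦ b])` in `(φ_p, φ_q)`. -/
theorem pairing_pair (c₀ p q : Fin d) (hpq : p ≠ q) (φ : Fin d → Fin d → ℂ) (u : (Fin d → Fin d) → ℂ) :
    (∑ v : Fin d → Fin d,
        (∏ j, if j ∈ ({p, q} : Finset (Fin d)) then φ j (v j) else if v j = c₀ then 1 else 0) * u v) =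
      ∑ ab : Fin d × Fin d, φ p ab.1 * φ q ab.2 *
        u (Function.update (Function.update (fun _ => c₀) p ab.1) q ab.2) := by
  classical
  set f : Fin d × Fin d → (Fin d → Fin d) :=
    fun ab => Function.update (Function.update (fun _ => c₀) p ab.1) q ab.2 with hf
  have hfp : ∀ ab : Fin d × Fin d, f ab p = ab.1 := fun ab => by
    simp [hf, Function.update_of_ne hpq]
  have hfq : ∀ ab : Fin d × Fin d, f ab q = ab.2 := fun ab => by simp [hf]
  have hfo : ∀ ab : Fin d × Fin d, ∀ j, j ≠ p → j ≠ q → f ab j = c₀ := fun ab j hjp hjq => by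
    simp [hf, Function.update_of_ne hjq, Function.update_of_ne hjp]
  have hinj : Set.InjOn f (univ : Finset (Fin d × Fin d)) := by
    intro ab _ ab' _ h
    have h1 := congrFun h p
    have h2 := congrFun h q
    rw [hfp, hfp] at h1
    rw [hfq, hfq] at h2
    exact Prod.ext h1 h2
  have hzero : ∀ v ∈ (univ : Finset (Fin d → Fin d)), v ∉ univ.image f →
      (∏ j, if j ∈ ({p, q} : Finset (Fin d)) then φ j (v j) else if v j = c₀ then 1 else 0) * u v = 0 := by
    intro v _ hv
    by_contra hne
    apply hv
    have hP := prod_ne_zero_iff.mp (left_ne_zero_of_mul hne)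
    refine mem_image.mpr ⟨(v p, v q), mem_univ _, ?_⟩
    funext j
    by_cases hjp : j = p
    · subst hjp; exact hfp _
    · by_cases hjq : j = q
      · subst hjq; exact hfq _
      · have := hP j (mem_univ j)
        simp only [mem_insert, mem_singleton, hjp, hjq, or_self, if_false] at this
        have hvj : v j = c₀ := by by_contra h; exact this (by simp [h])
        rw [hfo _ j hjp hjq, hvj]
  rw [← sum_subset (subset_univ (univ.image f)) hzero, sum_image hinj]
  refine sum_congr rfl fun ab _ => ?_
  have hprod : (∏ j, if j ∈ ({p, q} : Finset (Fin d)) then φ j (f ab j) else if f ab j = c₀ then 1 else 0) =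
      φ p ab.1 * φ q ab.2 := by
    rw [← Finset.prod_subset (subset_univ ({p, q} : Finset (Fin d)))]
    · rw [prod_pair hpq, hfp, hfq]
      simp [hpq]
    · intro j _ hj
      have hjp : j ≠ p := fun h => hj (by simp [h])
      have hjq : j ≠ q := fun h => hj (by simp [h])
      simp [hj, hfo ab j hjp hjq]
  rw [hprod]

/-- **Killing a pair term.**  A term with `S = {p, q}` whose `u`-factor `g(a,b) = u(c₀[p ↦ a][q ↦ b])` satisfies the
bilinear condition `Σ_{a,b} φ_p(a) g(a,b) φ_q(b) = 0` is killed. -/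
theorem kill_pair (c₀ p q : Fin d) (hpq : p ≠ q) (φ : Fin d → Fin d → ℂ) (u : (Fin d → Fin d) → ℂ)
    (hbil : (∑ ab : Fin d × Fin d, φ p ab.1 * φ q ab.2 *
        u (Function.update (Function.update (fun _ => c₀) p ab.1) q ab.2)) = 0) :
    (∑ v : Fin d → Fin d,
        (∏ j, if j ∈ ({p, q} : Finset (Fin d)) then φ j (v j) else if v j = c₀ then 1 else 0) * u v) = 0 := by
  rw [pairing_pair c₀ p q hpq, hbil]

end LaplaceDual


end Summit.ValiantsHypothesis.ValiantsHypothesis.Theorems.RigidityForcesSymmetryRankRigidMinimalRepr
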